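import Mathlib
import Summits.ValiantsHypothesis.ValiantsHypothesis.Theorems.NewtonUnitEquationsTwoProductsPlanarCrossQuasiPoly
import HarnessLib

/-!
# Crux `TwoProducts` (stmt-ValiantsHypothesis-5906), planar cells at `m = 2`: a LINEAR per-cell bound (nesting)

Calibration (val-lit-p3 g13, NOTE §13.4 (a); desk CLAIM-FIRST #2 of 03:18Z).  For TWO tails against two tails, the visible
points of ONE weight-order cell number at most `#tailSupport/2 + 2` (`planarCell_two_linear`), hence `≤ 2t + 2` under
`t`-sparsity (`planarCellBound_two_linear`).  Together with the kernel negative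
`Theorems/TwoProducts/Negative/PlanarSlotBoundFalse.lean` (p600147: one cell with `K + 1 ≈ √(2t)` visible points) this
brackets the `m = 2` per-cell truth between `√(2t)` and `2t + 2` by theorems.

Proof (NESTING).  A visible point is a strict top of `supp((1+u₀)(1+u₁) − (1+v₀)(1+v₁)) ⊆ E ∪ (E + E)` (`E` = tail
support; `stub_logLinearisation`, p584485); at most one visible point of a cell lies in `E`
(`PlanarCell.eq_of_visible_mem_tailSupport`); a visible point outside `E` has a decomposition `g + g'` with `g ≽ g'` in the
cell order, and for two DISTINCT visible points of the cell the intervals `[g', g]`, `[h', h]` are STRICTLY NESTED (if they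
were disjoint, crossing or shared an endpoint, one point would weigh at least as much as the other for EVERY weight of the
cell, contradicting the strict top of the lighter one).  Hence the upper endpoints are pairwise distinct, so are the lower
ones, and an upper endpoint equals a lower one only for the innermost point: `2·#(S ∖ E) ≤ #E + 1`.

Honest framing: fixed `m = 2` is trivially polynomial for the crux; this is a calibration of the PER-CELL count only.
`PlanarCross`, `PlanarCellBound`, the engine and the crux `TwoProducts` are OPEN; `VP ≠ VNP` is NOT proved.  No named
facts. [folklore]
-/

noncomputable section

-- Sub = Summit single-conjunct layout: the duplicated namespace component is mandated by the tree.
set_option linter.dupNamespace false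

open scoped BigOperators Pointwise
open MvPolynomial
open Summit.ValiantsHypothesis.ValiantsHypothesis.Theorems.NewtonUnitEquations.TwoProducts.FormalLogLinearisation

namespace Summit.ValiantsHypothesis.ValiantsHypothesis.Theorems.NewtonUnitEquations.TwoProducts.PlanarCell

/-- For two tails against two tails, `supp(∏(1+u_j) − ∏(1+v_j)) ⊆ E ∪ (E + E)`, `E` the tail support: every support point
is a tail exponent or a sum of two tail exponents. [folklore] -/
theorem mem_tailSupport_or_add_of_mem_support_tailDiff (u v : Fin 2 → MvPolynomial (Fin 2) ℂ) {l : Expo}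
    (hl : l ∈ (tailDiff u v).support) :
    l ∈ tailSupport u v ∨ ∃ g ∈ tailSupport u v, ∃ g' ∈ tailSupport u v, l = g + g' := by
  classical
  have hT : ∀ (w : Fin 2 → MvPolynomial (Fin 2) ℂ) (j : Fin 2) (e : Expo), e ∈ (w j).support →
      (w = u ∨ w = v) → e ∈ tailSupport u v := by
    rintro w j e he (rfl | rfl)
    · exact Finset.mem_union_left _ (Finset.mem_biUnion.2 ⟨j, Finset.mem_univ _, he⟩)
    · exact Finset.mem_union_right _ (Finset.mem_biUnion.2 ⟨j, Finset.mem_univ _, he⟩)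
  -- expand the two products
  have hexp : tailDiff u v = (u 0 + u 1 + u 0 * u 1) - (v 0 + v 1 + v 0 * v 1) := by
    unfold tailDiff
    simp only [Fin.prod_univ_two]
    ring
  rw [hexp] at hl
  have key : ∀ (w : Fin 2 → MvPolynomial (Fin 2) ℂ), (w = u ∨ w = v) →
      l ∈ (w 0 + w 1 + w 0 * w 1).support →
      l ∈ tailSupport u v ∨ ∃ g ∈ tailSupport u v, ∃ g' ∈ tailSupport u v, l = g + g' := by
    intro w hw hl
    rcases Finset.mem_union.1 (support_add hl) with h1 | h2
    · rcases Finset.mem_union.1 (support_add h1) with h | h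
      · exact Or.inl (hT w 0 l h hw)
      · exact Or.inl (hT w 1 l h hw)
    · obtain ⟨g, hg, g', hg', rfl⟩ := Finset.mem_add.1 (support_mul _ _ h2)
      exact Or.inr ⟨g, hT w 0 g hg hw, g', hT w 1 g' hg' hw, rfl⟩
  rcases Finset.mem_union.1 (support_sub (Fin 2) _ _ hl) with h | h
  · exact key u (Or.inl rfl) h
  · exact key v (Or.inr rfl) h

/-- **CROSSING / NESTING.**  Two distinct visible points `l = g + g'`, `l' = h + h'` of one cell compare CROSSWISE in the
cell order (measured by any weight `ζ` inducing the cell relation): `h ≺ g, g' ≺ h'` or `g ≺ h, h' ≺ g'` — neither point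
dominates the other termwise (else it would outweigh it for EVERY weight of the cell, against the strict top of the lighter
one).  For decompositions sorted as `g' ≼ g`, `h' ≼ h` this says the intervals `[g', g]`, `[h', h]` are STRICTLY NESTED.
[folklore] -/
theorem nested_of_visible (u v : Fin 2 → MvPolynomial (Fin 2) ℂ) (R : Expo → Expo → Prop)
    {ζ ξ ξ' : Fin 2 → ℝ} {l l' g g' h h' : Expo} (hne : l ≠ l')
    (hg : g ∈ tailSupport u v) (hg' : g' ∈ tailSupport u v) (hh : h ∈ tailSupport u v) (hh' : h' ∈ tailSupport u v)
    (hl : l = g + g') (hl' : l' = h + h')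
    (htop : IsStrictTop ξ (logSupport u v) l) (htop' : IsStrictTop ξ' (logSupport u v) l')
    (hRζ : ∀ e ∈ tailSupport u v, ∀ e' ∈ tailSupport u v, (R e e' ↔ wt ζ e ≤ wt ζ e'))
    (hRξ : ∀ e ∈ tailSupport u v, ∀ e' ∈ tailSupport u v, (R e e' ↔ wt ξ e ≤ wt ξ e'))
    (hRξ' : ∀ e ∈ tailSupport u v, ∀ e' ∈ tailSupport u v, (R e e' ↔ wt ξ' e ≤ wt ξ' e')) :
    (wt ζ h < wt ζ g ∧ wt ζ g' < wt ζ h') ∨ (wt ζ g < wt ζ h ∧ wt ζ h' < wt ζ g') := by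
  -- transfer of comparisons between the weights of the cell
  have tr : ∀ {η : Fin 2 → ℝ}, (∀ e ∈ tailSupport u v, ∀ e' ∈ tailSupport u v, (R e e' ↔ wt η e ≤ wt η e')) →
      ∀ {e e' : Expo}, e ∈ tailSupport u v → e' ∈ tailSupport u v → wt ζ e ≤ wt ζ e' → wt η e ≤ wt η e' := by
    intro η hRη e e' he he' hle
    exact (hRη e he e' he').1 ((hRζ e he e' he').2 hle)
  -- `l` does not dominate `l'` termwise, and conversely
  have nd1 : ¬ (wt ζ h ≤ wt ζ g ∧ wt ζ h' ≤ wt ζ g') := by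
    rintro ⟨h1, h2⟩
    have e1 := tr hRξ' hh hg h1
    have e2 := tr hRξ' hh' hg' h2
    have hlt := htop'.2 l htop.1 hne
    rw [hl, hl', wt_add, wt_add] at hlt
    linarith
  have nd2 : ¬ (wt ζ g ≤ wt ζ h ∧ wt ζ g' ≤ wt ζ h') := by
    rintro ⟨h1, h2⟩
    have e1 := tr hRξ hg hh h1
    have e2 := tr hRξ hg' hh' h2
    have hlt := htop.2 l' htop'.1 (Ne.symm hne)
    rw [hl, hl', wt_add, wt_add] at hlt
    linarith
  rcases lt_or_ge (wt ζ h) (wt ζ g) with h1 | h1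
  · left
    refine ⟨h1, ?_⟩
    by_contra h2
    exact nd1 ⟨h1.le, not_lt.1 h2⟩
  · right
    rcases h1.lt_or_eq with h1 | h1
    · refine ⟨h1, ?_⟩
      by_contra h2
      exact nd2 ⟨h1.le, not_lt.1 h2⟩
    · exfalso
      rcases le_total (wt ζ g') (wt ζ h') with h2 | h2
      · exact nd2 ⟨h1.le, h2⟩
      · exact nd1 ⟨h1.ge, h2⟩

/-- **LINEAR PER-CELL BOUND AT `m = 2`.**  For two tails against two tails (no constant terms), every cell family `S` — visible
points of `supp D` with valid witness weights all inducing the same relation `R` on the tail support — has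
`#S ≤ #tailSupport/2 + 2`. [folklore] -/
theorem planarCell_two_linear (u v : Fin 2 → MvPolynomial (Fin 2) ℂ)
    (hu : ∀ j, coeff 0 (u j) = 0) (hv : ∀ j, coeff 0 (v j) = 0) (R : Expo → Expo → Prop) (S : Finset Expo)
    (hS : ∀ l ∈ S, ∃ ξ : Fin 2 → ℝ, ValidWeight u v ξ ∧ IsStrictTop ξ (logSupport u v) l ∧
      ∀ e ∈ tailSupport u v, ∀ e' ∈ tailSupport u v, (R e e' ↔ wt ξ e ≤ wt ξ e')) :
    S.card ≤ (tailSupport u v).card / 2 + 2 := by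
  classical
  set T := tailSupport u v with hT
  rcases S.eq_empty_or_nonempty with hS0 | ⟨l₀, hl₀⟩
  · simp [hS0]
  obtain ⟨ζ, -, -, hRζ⟩ := hS l₀ hl₀
  -- witnesses
  choose! ξ hval htop hRξ using hS
  -- every visible point is a support point of the difference of products
  have hsupp : ∀ l ∈ S, l ∈ (tailDiff u v).support := fun l hl =>
    ((stub_logLinearisation 2 u v hu hv (ξ l) (hval l hl) l).2 (htop l hl)).1
  -- the part of `S` inside the tail support has at most one element
  set S₁ := S.filter (fun l => l ∈ T) with hS₁
  set S₂ := S.filter (fun l => l ∉ T) with hS₂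
  have hS₁card : S₁.card ≤ 1 := by
    refine Finset.card_le_one.2 fun l hl l' hl' => ?_
    rw [hS₁, Finset.mem_filter] at hl hl'
    exact eq_of_visible_mem_tailSupport u v R hl.2 hl'.2 (htop l hl.1) (htop l' hl'.1) (hRξ l hl.1) (hRξ l' hl'.1)
  -- sorted decompositions of the points outside the tail support
  have hdec : ∀ l ∈ S₂, ∃ p : Expo × Expo, p.1 ∈ T ∧ p.2 ∈ T ∧ l = p.1 + p.2 ∧ wt ζ p.2 ≤ wt ζ p.1 := by
    intro l hl
    rw [hS₂, Finset.mem_filter] at hl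
    rcases mem_tailSupport_or_add_of_mem_support_tailDiff u v (hsupp l hl.1) with h | ⟨g, hg, g', hg', rfl⟩
    · exact absurd h hl.2
    · rcases le_total (wt ζ g') (wt ζ g) with hle | hle
      · exact ⟨(g, g'), hg, hg', rfl, hle⟩
      · exact ⟨(g', g), hg', hg, add_comm g g', hle⟩
  choose! dec hdec1 hdec2 hdecsum hdecsort using hdec
  -- nesting between distinct points of `S₂`
  have hnest : ∀ l ∈ S₂, ∀ l' ∈ S₂, l ≠ l' →
      (wt ζ (dec l').1 < wt ζ (dec l).1 ∧ wt ζ (dec l).2 < wt ζ (dec l').2) ∨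
      (wt ζ (dec l).1 < wt ζ (dec l').1 ∧ wt ζ (dec l').2 < wt ζ (dec l).2) := by
    intro l hl l' hl' hne
    have hlS : l ∈ S := (Finset.mem_filter.1 (hS₂ ▸ hl)).1
    have hl'S : l' ∈ S := (Finset.mem_filter.1 (hS₂ ▸ hl')).1
    exact nested_of_visible u v R hne (hdec1 l hl) (hdec2 l hl) (hdec1 l' hl') (hdec2 l' hl')
      (hdecsum l hl) (hdecsum l' hl') (htop l hlS) (htop l' hl'S)
      hRζ (hRξ l hlS) (hRξ l' hl'S)
  -- upper and lower endpoints
  set A := S₂.image (fun l => (dec l).1) with hA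
  set B := S₂.image (fun l => (dec l).2) with hB
  have hAinj : Set.InjOn (fun l => (dec l).1) ↑S₂ := by
    intro l hl l' hl' heq
    by_contra hne
    rcases hnest l hl l' hl' hne with ⟨h1, -⟩ | ⟨h1, -⟩
    · simp only at heq; rw [heq] at h1; exact lt_irrefl _ h1
    · simp only at heq; rw [heq] at h1; exact lt_irrefl _ h1
  have hBinj : Set.InjOn (fun l => (dec l).2) ↑S₂ := by
    intro l hl l' hl' heq
    by_contra hne
    rcases hnest l hl l' hl' hne with ⟨-, h2⟩ | ⟨-, h2⟩
    · simp only at heq; rw [heq] at h2; exact lt_irrefl _ h2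
    · simp only at heq; rw [heq] at h2; exact lt_irrefl _ h2
  have hAcard : A.card = S₂.card := Finset.card_image_of_injOn hAinj
  have hBcard : B.card = S₂.card := Finset.card_image_of_injOn hBinj
  have hAT : A ⊆ T := fun x hx => by
    obtain ⟨l, hl, rfl⟩ := Finset.mem_image.1 hx
    exact hdec1 l hl
  have hBT : B ⊆ T := fun x hx => by
    obtain ⟨l, hl, rfl⟩ := Finset.mem_image.1 hx
    exact hdec2 l hl
  -- an upper endpoint equals a lower endpoint only for one point
  have hABeq : ∀ l ∈ S₂, ∀ l' ∈ S₂, (dec l).1 = (dec l').2 → l = l' := by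
    intro l hl l' hl' heq
    by_contra hne
    rcases hnest l hl l' hl' hne with ⟨h1, h2⟩ | ⟨h1, h2⟩
    · have := hdecsort l' hl'
      rw [← heq] at this
      linarith [hdecsort l hl]
    · have hs := hdecsort l hl
      rw [heq] at hs
      linarith
  have hABcard : (A ∩ B).card ≤ 1 := by
    refine Finset.card_le_one.2 fun x hx y hy => ?_
    obtain ⟨hxA, hxB⟩ := Finset.mem_inter.1 hx
    obtain ⟨hyA, hyB⟩ := Finset.mem_inter.1 hy
    obtain ⟨l, hl, rfl⟩ := Finset.mem_image.1 hxA
    obtain ⟨l', hl', hl'eq⟩ := Finset.mem_image.1 hxB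
    obtain ⟨k, hk, rfl⟩ := Finset.mem_image.1 hyA
    obtain ⟨k', hk', hk'eq⟩ := Finset.mem_image.1 hyB
    have e1 : l = l' := hABeq l hl l' hl' hl'eq.symm
    have e2 : k = k' := hABeq k hk k' hk' hk'eq.symm
    subst e1; subst e2
    -- now `(dec l).1 = (dec l).2` and `(dec k).1 = (dec k).2`; distinct `l ≠ k` contradicts nesting
    by_contra hxy
    have hlk : l ≠ k := fun h => hxy (by rw [h])
    rcases hnest l hl k hk hlk with ⟨h1, h2⟩ | ⟨h1, h2⟩
    · rw [hl'eq, hk'eq] at h2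
      linarith
    · rw [hk'eq, hl'eq] at h2
      linarith
  -- count
  have hunion : (A ∪ B).card ≤ T.card := Finset.card_le_card (Finset.union_subset hAT hBT)
  have hie : A.card + B.card = (A ∪ B).card + (A ∩ B).card := (Finset.card_union_add_card_inter A B).symm
  have hsplit : S.card = S₁.card + S₂.card := by
    rw [hS₁, hS₂]; exact (Finset.card_filter_add_card_filter_not _).symm
  omega

/-- **`PlanarCellBound` at `m = 2` with a LINEAR constant:** under `t`-sparsity of the four tails, a cell family has at most
`2t + 2` points (vs `≈ √(2t)` attained: `Negative/PlanarSlotBoundFalse.lean`). [folklore] -/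
theorem planarCellBound_two_linear (t : ℕ) (u v : Fin 2 → MvPolynomial (Fin 2) ℂ)
    (hu : ∀ j, coeff 0 (u j) = 0 ∧ (u j).support.card ≤ t) (hv : ∀ j, coeff 0 (v j) = 0 ∧ (v j).support.card ≤ t)
    (R : Expo → Expo → Prop) (S : Finset Expo)
    (hS : ∀ l ∈ S, ∃ ξ : Fin 2 → ℝ, ValidWeight u v ξ ∧ IsStrictTop ξ (logSupport u v) l ∧
      ∀ e ∈ tailSupport u v, ∀ e' ∈ tailSupport u v, (R e e' ↔ wt ξ e ≤ wt ξ e')) :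
    S.card ≤ 2 * t + 2 := by
  classical
  have h := planarCell_two_linear u v (fun j => (hu j).1) (fun j => (hv j).1) R S hS
  have hT : (tailSupport u v).card ≤ 4 * t := by
    calc (tailSupport u v).card
        ≤ (Finset.univ.biUnion fun j => (u j).support).card + (Finset.univ.biUnion fun j => (v j).support).card :=
          Finset.card_union_le _ _
      _ ≤ (∑ j : Fin 2, ((u j).support).card) + ∑ j : Fin 2, ((v j).support).card :=
          Nat.add_le_add Finset.card_biUnion_le Finset.card_biUnion_le
      _ ≤ (∑ _j : Fin 2, t) + ∑ _j : Fin 2, t :=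
          Nat.add_le_add (Finset.sum_le_sum fun j _ => (hu j).2) (Finset.sum_le_sum fun j _ => (hv j).2)
      _ = 4 * t := by simp; ring
  omega

end Summit.ValiantsHypothesis.ValiantsHypothesis.Theorems.NewtonUnitEquations.TwoProducts.PlanarCell

end
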